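import Literature.Analysis.FluidPDE.EnergySpaceRellich
import Mathlib.MeasureTheory.Measure.Prokhorov
import Mathlib.MeasureTheory.Measure.Portmanteau
import HarnessLib

/-!
# Stub `stub_sublevelCompact` (S1) of the line `dissipation-deficit-duality`
# (crux stmt-AnomalousDissipation-14091, `TaylorCertificates.FloorCertificate`)

DISSIPATION IS ITS OWN TIGHTNESS. On the energy space `H = Torus.energySpace (Fin 3)` (norm
topology, Borel σ-algebra) the Borel probability measures `μ` carried by the ball `{|u|² ≤ ρ}`
and with mean enstrophy `Torus.ensembleEnstrophy μ = ∫⁻ ‖∇u‖² dμ ≤ c < ∞` form a COMPACT subset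
of `ProbabilityMeasure H` (topology of weak convergence), granted lower semicontinuity of the mean
enstrophy (stub S0, taken as a hypothesis).

Proof. TIGHT: the enstrophy balls `K_t = {‖∇u‖² ≤ t}`, `t < ∞`, are norm-compact in `H`
(Rellich, `Torus.isCompact_setOf_eGradNormSq_le`) and `μ(K_tᶜ) ≤ μ{t ≤ ‖∇u‖²} ≤ c / t` by
Markov's inequality (`meas_ge_le_lintegral_div`, measurability `Torus.measurable_eGradNormSq_coe`);
hence relatively compact by Prokhorov (`isCompact_closure_of_isTightMeasureSet`). CLOSED: the
enstrophy condition is a sublevel set of the lower semicontinuous map S0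
(`LowerSemicontinuous.isClosed_preimage`); "carried by the closed ball `F`" means `μ F = 1`, and
along any filter of such measures converging weakly to `μ₀` the portmanteau inequality
(`ProbabilityMeasure.limsup_measure_closed_le_of_tendsto`) gives `1 = limsup μ F ≤ μ₀ F ≤ 1`.
Conclude with `IsCompact.of_isClosed_subset`.

References: Foias–Manley–Rosa–Temam 2001, Ch. IV §1.2 (Borel probability measures on `H`),
Ch. II §6 (Rellich); Billingsley, *Convergence of Probability Measures* (1999), Thm 2.1
(portmanteau) and Thm 5.1 (Prokhorov).
-/

set_option linter.dupNamespace false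

noncomputable section

namespace Summit.AnomalousDissipation.AnomalousDissipation.Theorems.TaylorCertificatesFloorCertificate

open MeasureTheory Filter Topology Set
open scoped ENNReal NNReal
open Literature.Analysis.FunctionSpaces Literature.Analysis.FluidPDE

/-! ## Tightness from a Markov bound -/

/-- **Markov's inequality ⇒ tightness** (`ℝ≥0∞`-valued, measurable version): measures with
`∫⁻ V dμ ≤ C < ∞` for a measurable `V : X → [0, ∞]` whose finite sublevel sets `{V ≤ R}`,
`R < ∞`, are compact form a tight set: `μ({V ≤ R}ᶜ) ≤ μ{R ≤ V} ≤ C / R`. [folklore] -/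
theorem isTightMeasureSet_of_lintegral_le_of_isCompact {X : Type*} [MeasurableSpace X]
    [TopologicalSpace X] {V : X → ℝ≥0∞} (hV : Measurable V)
    (hcpt : ∀ R : ℝ≥0∞, R ≠ ∞ → IsCompact {x | V x ≤ R}) {C : ℝ≥0∞} (hC : C ≠ ∞)
    {S : Set (Measure X)} (hS : ∀ μ ∈ S, ∫⁻ x, V x ∂μ ≤ C) : IsTightMeasureSet S := by
  rw [isTightMeasureSet_iff_exists_isCompact_measure_compl_le]
  intro ε hε
  rcases eq_or_ne ε ∞ with rfl | hεtop
  · exact ⟨∅, isCompact_empty, fun μ _ => le_top⟩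
  -- choose a finite level `R > 0` with `C ≤ ε R`
  obtain ⟨R, hRpos, hRtop, hR⟩ : ∃ R : ℝ≥0∞, R ≠ 0 ∧ R ≠ ∞ ∧ C ≤ ε * R := by
    have hCε : C / ε ≠ ∞ := ENNReal.div_ne_top hC hε.ne'
    refine ⟨C / ε + 1, by positivity, ENNReal.add_ne_top.2 ⟨hCε, ENNReal.one_ne_top⟩, ?_⟩
    calc C = ε * (C / ε) := (ENNReal.mul_div_cancel hε.ne' hεtop).symm
      _ ≤ ε * (C / ε + 1) := by gcongr; exact le_self_add
  refine ⟨{x | V x ≤ R}, hcpt R hRtop, fun μ hμ => ?_⟩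
  have hsub : {x | V x ≤ R}ᶜ ⊆ {x | R ≤ V x} := fun x hx => by
    simp only [mem_compl_iff, mem_setOf_eq, not_le] at hx
    exact hx.le
  calc μ {x | V x ≤ R}ᶜ ≤ μ {x | R ≤ V x} := measure_mono hsub
    _ ≤ (∫⁻ x, V x ∂μ) / R := meas_ge_le_lintegral_div hV.aemeasurable hRpos hRtop
    _ ≤ C / R := by gcongr; exact hS μ hμ
    _ ≤ ε := by rwa [ENNReal.div_le_iff hRpos hRtop]

/-! ## Closedness of "carried by a closed set" under weak convergence -/

/-- **Portmanteau ⇒ the probability measures carried by a closed set form a closed set** in the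
topology of weak convergence: if `F` is closed, `{μ | μ(Fᶜ) = 0}` is closed in
`ProbabilityMeasure Ω`. Along any filter of measures carried by `F` converging weakly to `μ₀`,
`1 = limsup μ(F) ≤ μ₀(F) ≤ 1` (`ProbabilityMeasure.limsup_measure_closed_le_of_tendsto`).
[cite: BillingsleyCPM1999, Thm. 2.1] -/
theorem isClosed_setOf_ae_mem_of_isClosed {Ω : Type*} [MeasurableSpace Ω] [TopologicalSpace Ω]
    [OpensMeasurableSpace Ω] [HasOuterApproxClosed Ω] {F : Set Ω} (hF : IsClosed F) :
    IsClosed {μ : ProbabilityMeasure Ω | ∀ᵐ x ∂(μ : Measure Ω), x ∈ F} := by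
  rw [isClosed_iff_forall_filter]
  intro μ₀ L hL hLA hLμ
  have hlim : Tendsto (fun μ : ProbabilityMeasure Ω => μ) L (𝓝 μ₀) := tendsto_id'.2 hLμ
  have hle := ProbabilityMeasure.limsup_measure_closed_le_of_tendsto hlim hF
  have hev : ∀ᶠ μ : ProbabilityMeasure Ω in L, (μ : Measure Ω) F = 1 := by
    filter_upwards [le_principal_iff.1 hLA] with μ hμ
    exact (prob_compl_eq_zero_iff hF.measurableSet).1 (mem_ae_iff.1 hμ)
  have h1 : L.limsup (fun μ : ProbabilityMeasure Ω => (μ : Measure Ω) F) = 1 := by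
    rw [limsup_congr hev, limsup_const]
  rw [h1] at hle
  have hμF : (μ₀ : Measure Ω) F = 1 := le_antisymm prob_le_one hle
  exact mem_ae_iff.2 ((prob_compl_eq_zero_iff hF.measurableSet).2 hμF)

/-! ## The stub -/

/-- **S1 `stub_sublevelCompact`** — DISSIPATION IS ITS OWN TIGHTNESS: given lower semicontinuity
of the mean enstrophy on `ProbabilityMeasure H` (S0), for every radius `ρ` and finite level `c`
the Borel probability measures on the energy space `H = Torus.energySpace (Fin 3)` carried by the
ball `{|u|² ≤ ρ}` with mean enstrophy `≤ c` form a COMPACT subset of `ProbabilityMeasure H`.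
TIGHT by Rellich (`Torus.isCompact_setOf_eGradNormSq_le`) and Markov, relatively compact by
Prokhorov (`isCompact_closure_of_isTightMeasureSet`), CLOSED by S0
(`LowerSemicontinuous.isClosed_preimage`) and portmanteau
(`isClosed_setOf_ae_mem_of_isClosed`). [cite: FMRTTurbulence2001, Ch. IV §1.2 with Ch. II §6] -/
theorem stub_sublevelCompact :
    (LowerSemicontinuous fun μ : ProbabilityMeasure (Torus.energySpace (Fin 3)) =>
      Torus.ensembleEnstrophy (μ : Measure (Torus.energySpace (Fin 3)))) →
    ∀ (ρ : ℝ) (c : ℝ≥0∞), c ≠ ⊤ →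
      IsCompact {μ : ProbabilityMeasure (Torus.energySpace (Fin 3)) |
        (∀ᵐ u ∂(μ : Measure (Torus.energySpace (Fin 3))), ‖u‖ ^ 2 ≤ ρ) ∧
          Torus.ensembleEnstrophy (μ : Measure (Torus.energySpace (Fin 3))) ≤ c} := by
  intro hlsc ρ c hc
  -- (1) tightness of the enstrophy sublevel set, (2) Prokhorov
  have htight : IsTightMeasureSet
      {((μ : ProbabilityMeasure (Torus.energySpace (Fin 3))) :
          Measure (Torus.energySpace (Fin 3))) |
        μ ∈ {μ : ProbabilityMeasure (Torus.energySpace (Fin 3)) |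
          (∀ᵐ u ∂(μ : Measure (Torus.energySpace (Fin 3))), ‖u‖ ^ 2 ≤ ρ) ∧
            Torus.ensembleEnstrophy (μ : Measure (Torus.energySpace (Fin 3))) ≤ c}} := by
    refine isTightMeasureSet_of_lintegral_le_of_isCompact
      (Torus.measurable_eGradNormSq_coe (d := Fin 3))
      (fun R hR => Torus.isCompact_setOf_eGradNormSq_le hR) hc ?_
    rintro _ ⟨μ, hμ, rfl⟩
    exact hμ.2
  have hK := isCompact_closure_of_isTightMeasureSet htight
  -- (3) closedness
  have hball : IsClosed {u : Torus.energySpace (Fin 3) | ‖u‖ ^ 2 ≤ ρ} :=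
    isClosed_le (by fun_prop) continuous_const
  have hA : IsClosed {μ : ProbabilityMeasure (Torus.energySpace (Fin 3)) |
      ∀ᵐ u ∂(μ : Measure (Torus.energySpace (Fin 3))), ‖u‖ ^ 2 ≤ ρ} :=
    isClosed_setOf_ae_mem_of_isClosed hball
  have hB : IsClosed {μ : ProbabilityMeasure (Torus.energySpace (Fin 3)) |
      Torus.ensembleEnstrophy (μ : Measure (Torus.energySpace (Fin 3))) ≤ c} :=
    hlsc.isClosed_preimage c
  exact hK.of_isClosed_subset (hA.inter hB) subset_closure

end Summit.AnomalousDissipation.AnomalousDissipation.Theorems.TaylorCertificatesFloorCertificate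

end
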